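import Literature.NumberTheory.Rogawski1990.ArchStableSumGWeyl     -- ★ p851917 PART 2 (this seat); brings ★ p851904 PART 1 `stableSumG`, `stableTwistG`, `stableTwistG_mul_archERhoG` and ★ `archERhoG_mul_archRG_slotPerm`, `prod_sign_mul_self`
import HarnessLib

/-!
# `stableSumG`, PART 3 — THE CLASS-SUM READING: on the partner points `F S′ = R′ · Φ` ⟹ `stableSumG F S′ c = R′(c) · Σ_{ρ ∈ partnerPerms S′} Φ(ρ·c)`
# (the rider (4) READ-G ∕ (11) consume by name; Shelstad 1979 Lemma 4.2; Rogawski 1990 §4.1 (4.1.1), §4.3 (4.3.1))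

Topic `NumberTheory/Rogawski1990`; namespace `Literature.NumberTheory.Rogawski1990`.  THEOREMS ONLY (no definition, no instance, no notation, no axiom, no named fact, no `sorry`).
Cell `pub/hodgecm-mathlib`, crux H413 = `stmt-HodgeConjecture-24833`, road «N8-INNER» brick **(2) «STABLE-SUM-G»**, rider asked BY NAME by (4) READ-G LH7-p01 (g7) 2026-09-02T15:48:05Z
(«the `partnerWeight • Σ_{partnerPerms}` bridge … I consume it by name for §3′, no second `stableSumG`»); seat LH10-p02 (g9).

THE IDENTITY.  The unit twist of PART 1 was DESIGNED so that `u_ρ(c) · R′(ρ·c) = R′(c)` (`archRG` = Shelstad's signed `R_T`; ★ `archERhoG_mul_archRG_slotPerm`: the Weyl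
denominator `archERhoG·archRG` alternates, and `u_ρ · archERhoG = sign ρ · archERhoG ∘ ρ`): §1 `stableTwistG_mul_archRG_slotPerm`.  Hence for an `R′`-NORMALISED family — `F S′ = archRG S′ · Φ`
on the partner points of `c`, `Φ` the honest (class-function) orbital reading — the stable sum is `R′(c)` times the PLAIN partner sum of `Φ`:
**`stableSumG F S′ c = archRG S′ c · Σ_{ρ ∈ partnerPerms S′} Φ (slotPerm ρ c)`** (§2 `stableSumG_eq_archRG_mul_sum`, global form `stableSumG_archRG_mul`, and on `RegG S′` the
division form `stableSumG_eq_archRG_mul_sum_div_of_mem_regG` with `Φ = F S′ ∕ archRG S′`).  The right-hand partner sum is exactly the index set of ★ `transfFamReg` ∕ ★ (4) READ-G's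
`finsum_mem_setOf_isStablyConj_out_eq_partnerWeight_mul_sum` (each stable CLASS counted `|W_s(w)|` times per compact place — `2` at a `(2,1)` place, `6` at a `(3,0)` place — which ★
`partnerWeight` undoes), so (4)∕(11) re-spell `stableSumG (orbFamGExt …)` as `R′ ·` (class sum) with NO second stable-sum object.
HONEST LABEL: count-neutral algebra; HC_CM is proved only modulo the 7 printed citations (2 remaining: hLiu418 = stmt-HodgeConjecture-24832, h413 = stmt-HodgeConjecture-24833) until rung 0
closes.

## References
* [Shelstad1979] D. Shelstad, *Characters and inner forms of a quasi-split group over ℝ*, Compositio Math. 39 (1979) 11–45, §4 p. 22 (`R_T`), Lemma 4.2 (p. 23).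
* [Rogawski1990] J. D. Rogawski, *Automorphic Representations of Unitary Groups in Three Variables*, Ann. of Math. Stud. 123 (1990), §4.1 (4.1.1) p. 39 (`Φ^st`), §4.3 (4.3.1) p. 43.
-/

set_option autoImplicit false

noncomputable section

open Complex Finset Equiv
open scoped Classical
open Literature.NumberTheory.Automorphic.ArchCartan

namespace Literature.NumberTheory.Rogawski1990

variable {W : Type*} [Fintype W] [DecidableEq W]

/-! ## §1 The twist eats the relabelled normaliser -/

/-- **`u_ρ(c) · R′(ρ·c) = R′(c)`** for a partner relabelling `ρ ∈ partnerPerms S′`: the unit twist converts the signed normaliser at the partner point back to the normaliser at `c`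
(★ `archERhoG_mul_archRG_slotPerm` + ★ `stableTwistG_mul_archERhoG`, the unit `archERhoG` cancelled, `sign² = 1`). [cite: Shelstad1979, §4 p. 22; Lemma 4.2 (p. 23)] -/
theorem stableTwistG_mul_archRG_slotPerm {S' : Finset W} {ρ : W → Perm (Fin 3)} (hρ : ρ ∈ partnerPerms S') (c : W → Fin 3 → ℝ) :
    stableTwistG S' ρ c * archRG S' (slotPerm ρ c) = archRG S' c := by
  have hE : archERhoG S' c ≠ 0 := archERhoG_ne_zero' S' c
  have hEρ : archERhoG S' (slotPerm ρ c) ≠ 0 := archERhoG_ne_zero' S' _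
  apply mul_left_cancel₀ (mul_ne_zero hE hEρ)
  have h1 := stableTwistG_mul_archERhoG S' ρ c
  have h2 := archERhoG_mul_archRG_slotPerm hρ c
  have h3 := prod_sign_mul_self ρ
  calc archERhoG S' c * archERhoG S' (slotPerm ρ c) * (stableTwistG S' ρ c * archRG S' (slotPerm ρ c))
      = (stableTwistG S' ρ c * archERhoG S' c) * (archERhoG S' (slotPerm ρ c) * archRG S' (slotPerm ρ c)) := by ring
    _ = ((∏ w, (Equiv.Perm.sign (ρ w) : ℂ)) * archERhoG S' (slotPerm ρ c)) * ((∏ w, (Equiv.Perm.sign (ρ w) : ℂ)) * (archERhoG S' c * archRG S' c)) := by rw [h1, h2]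
    _ = ((∏ w, (Equiv.Perm.sign (ρ w) : ℂ)) * (∏ w, (Equiv.Perm.sign (ρ w) : ℂ))) * archERhoG S' (slotPerm ρ c) * (archERhoG S' c * archRG S' c) := by ring
    _ = archERhoG S' c * archERhoG S' (slotPerm ρ c) * archRG S' c := by rw [h3]; ring

/-- The twist as a ratio of normalisers on the regular set: `u_ρ(c) = R′(c) ∕ R′(ρ·c)` (`c ∈ RegG S′`). [cite: Shelstad1979, §4 p. 22] -/
theorem stableTwistG_eq_archRG_div_of_mem_regG {S' : Finset W} {ρ : W → Perm (Fin 3)} (hρ : ρ ∈ partnerPerms S') {c : W → Fin 3 → ℝ} (hc : c ∈ RegG S') :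
    stableTwistG S' ρ c = archRG S' c / archRG S' (slotPerm ρ c) := by
  have hR : archRG S' (slotPerm ρ c) ≠ 0 := archRG_ne_zero_of_mem_regG ((slotPerm_mem_regG_iff hρ c).2 hc)
  rw [eq_div_iff hR, stableTwistG_mul_archRG_slotPerm hρ c]

/-! ## §2 The class-sum reading of the stable sum -/

/-- **THE CLASS-SUM READING**: if on the partner points of `c` the family is `R′`-normalised, `F S′ (ρ·c) = archRG S′ (ρ·c) · Φ (ρ·c)` (`ρ ∈ partnerPerms S′`), then
**`stableSumG F S′ c = archRG S′ c · Σ_{ρ ∈ partnerPerms S′} Φ (slotPerm ρ c)`** — `R′(c)` times the PLAIN partner sum of the class function. [cite: Rogawski1990, §4.1 (4.1.1) p. 39; §4.3 (4.3.1) p. 43]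
[cite: Shelstad1979, Lemma 4.2 (p. 23)] -/
theorem stableSumG_eq_archRG_mul_sum {F : Finset W → (W → Fin 3 → ℝ) → ℂ} {Φ : (W → Fin 3 → ℝ) → ℂ} {S' : Finset W} {c : W → Fin 3 → ℝ}
    (h : ∀ ρ ∈ partnerPerms S', F S' (slotPerm ρ c) = archRG S' (slotPerm ρ c) * Φ (slotPerm ρ c)) :
    stableSumG F S' c = archRG S' c * ∑ ρ ∈ partnerPerms S', Φ (slotPerm ρ c) := by
  rw [stableSumG, Finset.mul_sum]
  refine Finset.sum_congr rfl fun ρ hρ => ?_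
  rw [h ρ hρ, ← mul_assoc, stableTwistG_mul_archRG_slotPerm hρ]

/-- **Global form**: the stable sum of the `R′`-normalised family `S′ ↦ archRG S′ · Φ S′` is `archRG S′ c · Σ_ρ Φ S′ (ρ·c)`. [cite: Rogawski1990, §4.1 (4.1.1) p. 39]
[cite: Shelstad1979, Lemma 4.2 (p. 23)] -/
theorem stableSumG_archRG_mul (Φ : Finset W → (W → Fin 3 → ℝ) → ℂ) (S' : Finset W) (c : W → Fin 3 → ℝ) :
    stableSumG (fun S c => archRG S c * Φ S c) S' c = archRG S' c * ∑ ρ ∈ partnerPerms S', Φ S' (slotPerm ρ c) :=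
  stableSumG_eq_archRG_mul_sum fun _ _ => rfl

/-- **Division form on the regular set**: for `c ∈ RegG S′` (all partner points regular, `R′ ≠ 0` there), `stableSumG F S′ c = archRG S′ c · Σ_ρ F S′ (ρ·c) ∕ archRG S′ (ρ·c)` — the stable
sum is `R′` times the partner sum of the un-normalised readings `Φ = F ∕ R′`. [cite: Rogawski1990, §4.3 (4.3.1) p. 43] [cite: Shelstad1979, §4 p. 22] -/
theorem stableSumG_eq_archRG_mul_sum_div_of_mem_regG (F : Finset W → (W → Fin 3 → ℝ) → ℂ) {S' : Finset W} {c : W → Fin 3 → ℝ} (hc : c ∈ RegG S') :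
    stableSumG F S' c = archRG S' c * ∑ ρ ∈ partnerPerms S', F S' (slotPerm ρ c) / archRG S' (slotPerm ρ c) := by
  refine stableSumG_eq_archRG_mul_sum (Φ := fun c' => F S' c' / archRG S' c') fun ρ hρ => ?_
  have hR : archRG S' (slotPerm ρ c) ≠ 0 := archRG_ne_zero_of_mem_regG ((slotPerm_mem_regG_iff hρ c).2 hc)
  rw [mul_div_cancel₀ _ hR]

/-- **The un-normalised reading of the stable sum on the regular set**: `stableSumG F S′ c ∕ archRG S′ c = Σ_ρ F S′ (ρ·c) ∕ archRG S′ (ρ·c)` — the stable sum of the class function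
`Φ = F ∕ R′` is the PLAIN (twist-free) partner sum. [cite: Rogawski1990, §4.1 (4.1.1) p. 39] -/
theorem stableSumG_div_archRG_of_mem_regG (F : Finset W → (W → Fin 3 → ℝ) → ℂ) {S' : Finset W} {c : W → Fin 3 → ℝ} (hc : c ∈ RegG S') :
    stableSumG F S' c / archRG S' c = ∑ ρ ∈ partnerPerms S', F S' (slotPerm ρ c) / archRG S' (slotPerm ρ c) := by
  rw [stableSumG_eq_archRG_mul_sum_div_of_mem_regG F hc, mul_div_cancel_left₀ _ (archRG_ne_zero_of_mem_regG hc)]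

/-- **Symmetric class functions are reproduced**: if moreover `Φ` is invariant under every partner relabelling at `c`, the stable sum is `|partnerPerms S′| · archRG S′ c · Φ c`.
[cite: Shelstad1979, Lemma 4.2 (p. 23)] -/
theorem stableSumG_eq_card_mul_of_forall_eq {F : Finset W → (W → Fin 3 → ℝ) → ℂ} {Φ : (W → Fin 3 → ℝ) → ℂ} {S' : Finset W} {c : W → Fin 3 → ℝ}
    (h : ∀ ρ ∈ partnerPerms S', F S' (slotPerm ρ c) = archRG S' (slotPerm ρ c) * Φ (slotPerm ρ c)) (hΦ : ∀ ρ ∈ partnerPerms S', Φ (slotPerm ρ c) = Φ c) :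
    stableSumG F S' c = ((partnerPerms S').card : ℂ) * (archRG S' c * Φ c) := by
  rw [stableSumG_eq_archRG_mul_sum h, Finset.sum_congr rfl hΦ, Finset.sum_const, nsmul_eq_mul]
  ring

end Literature.NumberTheory.Rogawski1990

end
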